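import Summits.QuantumFields.YangMills.Theses.ConvexGribovBody
import Summits.QuantumFields.QCD.Theorems.YangMills.Negative.WithoutLinear

/-!
# `ContinuumLegGivenGap` — negative-side support: the linearity conjunct is load-bearing
# (and the `∀ r` hypothesis can be vacuous)

Support file for crux `stmt-QuantumFields-8782`
(`Summit.QuantumFields.YangMills.Theses.ConvexGribovBody.ContinuumLegGivenGap`), extracted from the standing
disprover's work file `Cruxes/ContinuumLegGivenGap/Disproof.lean` (cycle 1, §2).  Companion of
`Negative/PerGroupBurden.lean` (non-abelianness is load-bearing, `G = PUnit`).  Tree objects only, no `def`;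
the crux's hypothesis and conclusion are written out verbatim.

* `isEmpty_latticeRep_indiscrete`: under the indiscrete topology a non-trivial group has NO faithful
  continuous unitary matrix representation (it would be Hausdorff).
* `continuumLegGivenGap_false_without_linear`: weakening `IsCompactSimpleLieGroup G`
  (`= IsSimpleCompactGroup G ∧ Nonempty (LatticeRep G)`) to `IsSimpleCompactGroup G` makes the crux FALSE —
  witness the dihedral group `D₃` with the indiscrete topology (compact, connected, non-abelian, no proper
  closed subgroup: landed `isSimpleCompactGroup_indiscrete`): the hypothesis `∀ r : LatticeRep G, …` holds
  VACUOUSLY while the conclusion needs `∃ r`.  So the `∀ r` hypothesis of the crux has content only through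
  the representation that `IsCompactSimpleLieGroup` supplies. [folklore]
-/

noncomputable section

open Filter Topology
open Literature.MathematicalPhysics.QuantumLattice Literature.MathematicalPhysics.QuantumFieldTheory
open Summit.QuantumFields.YangMills.Theses

namespace Summit.QuantumFields.YangMills.Theorems.ContinuumLegGivenGap.Negative

/-- **Under the indiscrete topology a group with two elements has no lattice representation**: a faithful
continuous map into matrices makes it Hausdorff (`T2Space.of_injective_continuous`), so `{1}` is closed,
so `{1}ᶜ ∈ {∅, univ}` — both absurd. [folklore] -/
theorem isEmpty_latticeRep_indiscrete (H : Type) [Group H] [Nontrivial H] :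
    IsEmpty (@LatticeRep H _ ⊤) := by
  letI : TopologicalSpace H := ⊤
  refine ⟨fun r => ?_⟩
  haveI : T2Space H := .of_injective_continuous r.injective r.continuous
  have hcl : IsClosed ({1} : Set H) := isClosed_singleton
  obtain ⟨a, ha⟩ := exists_ne (1 : H)
  rcases (TopologicalSpace.isOpen_top_iff _).1 (isOpen_compl_iff.2 hcl) with hc | hc
  · rw [Set.compl_empty_iff] at hc
    have : a ∈ ({1} : Set H) := hc ▸ Set.mem_univ _
    exact ha (Set.mem_singleton_iff.1 this)
  · have : (1 : H) ∈ ({1} : Set H)ᶜ := hc ▸ Set.mem_univ _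
    exact this rfl

/-- **`ContinuumLegGivenGap` is false without linearity.**  With `IsCompactSimpleLieGroup G` weakened to
`IsSimpleCompactGroup G` (hypothesis and conclusion otherwise verbatim) the statement FAILS at `G = D₃` with
the indiscrete topology: `IsSimpleCompactGroup D₃` (`isSimpleCompactGroup_indiscrete`), the clustering
hypothesis holds vacuously (`LatticeRep D₃` is empty, `isEmpty_latticeRep_indiscrete`), and the conclusion
asks for a lattice representation. [folklore] -/
theorem continuumLegGivenGap_false_without_linear :
    ¬ (∀ (G : Type) [Group G] [TopologicalSpace G] [IsTopologicalGroup G] [CompactSpace G],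
        IsSimpleCompactGroup G →
          letI : MeasurableSpace G := borel G
          haveI : BorelSpace G := ⟨rfl⟩
          (∀ r : LatticeRep G, ∃ β₀ : ℝ, ∀ β : ℝ, β₀ ≤ β → ∃ m : ℝ, 0 < m ∧ ∃ S₁ : ℕ,
            ∀ A B : YMSpecies G, ∃ C : ℝ, ∀ S n : ℕ, S₁ ≤ S → n ≤ S →
              |latticeConnectedCorr r.ρ β (2 * S + 1) A.F B.F n| ≤ C * Real.exp (-(m * n))) →
          ∃ (r : LatticeRep G) (sch : SpeciesScheme (YMSpecies G)) (T : OSData (YMSpecies G) 4),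
            IsYangMillsFor r sch T ∧ T.IsNontrivial r.curvature ∧ T.IsNonGaussian r.curvature ∧
              ∃ Δ > 0, T.HasMassGap Δ ∧ HasLatticeMassGap r sch Δ) := by
  intro h
  letI : TopologicalSpace (DihedralGroup 3) := ⊤
  haveI : IsTopologicalGroup (DihedralGroup 3) :=
    { continuous_mul := continuous_top, continuous_inv := continuous_top }
  letI : MeasurableSpace (DihedralGroup 3) := borel _
  haveI : BorelSpace (DihedralGroup 3) := ⟨rfl⟩
  have hna : ∃ a b : DihedralGroup 3, a * b ≠ b * a :=
    ⟨DihedralGroup.r 1, DihedralGroup.sr 0, by decide⟩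
  have hE := isEmpty_latticeRep_indiscrete (DihedralGroup 3)
  obtain ⟨r, -⟩ := h (DihedralGroup 3)
    (Summit.QuantumFields.QCD.Theorems.YangMills.Negative.isSimpleCompactGroup_indiscrete _ hna)
    (fun r => (hE.false r).elim)
  exact hE.false r

end Summit.QuantumFields.YangMills.Theorems.ContinuumLegGivenGap.Negative

end
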